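import Literature.Computability.AlgebraicComplexity.BorderRankMatMulThreeTripleRun1
import Literature.Computability.AlgebraicComplexity.BorderRankMatMulThreeTripleRun2
import Literature.Computability.AlgebraicComplexity.BorderRankMatMulThreeTripleRun3
import Literature.Computability.AlgebraicComplexity.BorderRankMatMulThreeTripleRun4
import Literature.Computability.AlgebraicComplexity.BorderRankMatMulThreeTripleRun5
import Literature.Computability.AlgebraicComplexity.BorderRankMatMulThreeTripleRun6
import Literature.Computability.AlgebraicComplexity.BorderRankMatMulThreeTripleRun7
import Literature.Computability.AlgebraicComplexity.BorderRankMatMulThreeTripleRun8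
import Literature.Computability.AlgebraicComplexity.BorderRankMatMulThreeTripleRun9
import Literature.Computability.AlgebraicComplexity.BorderRankMatMulThreeTripleRun10
import Literature.Computability.AlgebraicComplexity.BorderRankMatMulThreeTripleRun11
import Literature.Computability.AlgebraicComplexity.BorderRankMatMulThreeTripleRun12
import Literature.Computability.AlgebraicComplexity.BorderRankMatMulThreeTripleRun13
import Literature.Computability.AlgebraicComplexity.BorderRankMatMulThreeTripleRun14
import Literature.Computability.AlgebraicComplexity.BorderRankMatMulThreeTripleRun15
import Literature.Computability.AlgebraicComplexity.BorderRankMatMulThreeTripleRun16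
import Mathlib.Tactic.IntervalCases
import HarnessLib

/-!
# Borel-fixed candidates of `⟨3,3,3⟩`: the `(111)` test kills every survivor triple

Topic `Literature/Computability/AlgebraicComplexity`. Assembly of the sixteen kernel runs
`BorderRankMatMulThreeTripleRun1..16.lean`:

* `MatMul3.bound111_le_of_mem_survivors8` — **for any three of CHL's eight surviving
  `(110)`-profiles, the certified `(111)` dimension `Ker.bound111` is `≤ 15`** ("none of the
  `8³` triples passes the `(111)` test").

## References

* A. Conner, A. Harper, J. M. Landsberg, *New lower bounds for matrix multiplication and `det₃`*,
  Forum Math. Pi 11 (2023) e17, arXiv:1911.07981 — §6. [ConnerHarperLandsberg2023]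
-/

namespace Literature.Computability.AlgebraicComplexity

namespace BorderApolarity

namespace MatMul3

/-- The `(111)` bound on `(S_x, S_y, S_z)` is `≤ 15` for all `x, y, z < 8`. [cite: ConnerHarperLandsberg2023, §6] -/
theorem tripleRun (x y z : ℕ) (hx : x < 8) (hy : y < 8) (hz : z < 8) :
    Ker.bound111 (survivors8.getD x []) (survivors8.getD y []) (survivors8.getD z []) ≤ 15 := by
  by_cases h4 : y < 4
  · interval_cases x
    exacts [tripleRun_0_lo y z h4 hz, tripleRun_1_lo y z h4 hz, tripleRun_2_lo y z h4 hz,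
      tripleRun_3_lo y z h4 hz, tripleRun_4_lo y z h4 hz, tripleRun_5_lo y z h4 hz,
      tripleRun_6_lo y z h4 hz, tripleRun_7_lo y z h4 hz]
  · have h4' : 4 ≤ y := Nat.le_of_not_lt h4
    interval_cases x
    exacts [tripleRun_0_hi y z h4' hy hz, tripleRun_1_hi y z h4' hy hz, tripleRun_2_hi y z h4' hy hz,
      tripleRun_3_hi y z h4' hy hz, tripleRun_4_hi y z h4' hy hz, tripleRun_5_hi y z h4' hy hz,
      tripleRun_6_hi y z h4' hy hz, tripleRun_7_hi y z h4' hy hz]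

/-- A member of `survivors8` is one of its eight entries. [folklore] -/
theorem exists_getD_of_mem_survivors8 {p : List (List (ℕ × ℕ) × ℕ)} (h : p ∈ survivors8) :
    ∃ x : ℕ, x < 8 ∧ survivors8.getD x [] = p := by
  obtain ⟨i, hi, rfl⟩ := List.mem_iff_getElem.1 h
  refine ⟨i, ?_, ?_⟩
  · have : survivors8.length = 8 := rfl
    omega
  · rw [List.getD_eq_getElem?_getD, List.getElem?_eq_getElem hi, Option.getD_some]

/-- **No triple of surviving profiles passes the `(111)` test**: the certified `(111)` dimension
is `≤ 15`. [cite: ConnerHarperLandsberg2023, §6] -/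
theorem bound111_le_of_mem_survivors8 {p₁ p₂ p₃ : List (List (ℕ × ℕ) × ℕ)}
    (h₁ : p₁ ∈ survivors8) (h₂ : p₂ ∈ survivors8) (h₃ : p₃ ∈ survivors8) :
    Ker.bound111 p₁ p₂ p₃ ≤ 15 := by
  obtain ⟨x, hx, rfl⟩ := exists_getD_of_mem_survivors8 h₁
  obtain ⟨y, hy, rfl⟩ := exists_getD_of_mem_survivors8 h₂
  obtain ⟨z, hz, rfl⟩ := exists_getD_of_mem_survivors8 h₃
  exact tripleRun x y z hx hy hz

end MatMul3

end BorderApolarity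

end Literature.Computability.AlgebraicComplexity
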